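import Summits.BirchSwinnertonDyer.BirchSwinnertonDyer.Theorems.ResidualThetaTransportAtTwoDefs
import Summits.BirchSwinnertonDyer.BirchSwinnertonDyer.Theorems.ResidualThetaTransportAtTwoResidualSignedLambdaLowerCMAtTwoColemanPlusHomTwist
import Summits.BirchSwinnertonDyer.BirchSwinnertonDyer.Theorems.ResidualThetaTransportAtTwoResidualSignedLambdaLowerCMAtTwoColemanSidePush
import HarnessLib

/-!
# The pinned plus Coleman maps at `v ∣ 2` form a `ℤ₂⟦X⟧ˣ`-TORSOR (S129): any second pinned map is `u · π.col`, and the unit `u` is invisible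
# to the `hERL` value clause and to the clause-(7) quotient `π.colocdQuot z`

Route `ResidualThetaTransportAtTwo` (RTT), crux RSL_g `ResidualSignedLambdaLowerCMAtTwo` (stmt-BirchSwinnertonDyer-22608), hold KZ_g
`KatoZetaCMFormAtTwoSupply` (stmt-BirchSwinnertonDyer-24105). Width seat `prover-bsd-wall-tp2-p2x-w2` g21 (`--supports 22608 --as helper`,
closes nothing). THEOREMS ONLY (no definition, no named fact, no instance, no notation, no `sorry`). Nothing about any curve or form is asserted
unconditionally; BSD is not proved by any of this; 22608 / 24105 / 26074 stay OPEN / HOLD.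

WHY THIS FILE. STUB-PLAN `stub_cmLambdaLower` rev 26.4, S129 («TORSOR TRANSFER OF RECORD = k1-g23») / T78 / Q118: the `(i)`-half of the KZ_g glue
`katoZetaCMAtTwo_of_facts` reads Kato's values along whichever Honda datum print computes with, and transfers them to the pins' own plus Coleman map
`π.col` up to ONE unit `u ∈ ℤ₂⟦X⟧ˣ`, which the value clause `hERL` and the clause-(7) count absorb. The kernel-checked sketch
`Cruxes/ResidualThetaCountLowerPureAtTwo` / mirror `Sketch_sidea_k1_g23.lean` (stub-ideation k1 g23; concurrent duplicate k2 g22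
`col_eq_unit_mul_of_datum`) is not importable from `Theorems/`; this is its PORT — statements verbatim up to (a) namespaces, (b) the twist being written
in the tree's RELATIONAL currency `∀ z z', (∀ a, z' a = z (g⁻¹ • a)) → col z' = (1 + X) · col z` of `SignedColemanImage.exists_colemanPlusHom_coeff_two_twist`
instead of through a precomposition `def`, and (c) the two auxiliary `def`s of the sketch (`descend`, `quotSpanImageSmulEquiv`) being inlined.
Credit: stub-ideation k1 g23 (every statement), k2 g22 (the same seam, independently), k4 g20 (`exists_col_twist`, the pins' own twist).

* §1 `exists_unit_mul_eq_of_twist` — two SURJECTIVE `A`-linear maps `M → A⟦X⟧` with the same kernel and the same `(1+X)`-twist differ by a unit of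
  `A⟦X⟧` (`eq_mul_map_one_of_map_X_mul`: an `A`-linear self-map of `A⟦X⟧` commuting with `X` is multiplication by its value at `1`, from the landed
  finite-to-full lemma `ColemanSideInjective.apply_smul_eq_smul_of_X_of_C`; plus the first isomorphism theorem).
* §2 `smul_eq_of_isTopGenerator` / `inv_smul_eq_of_isTopGenerator` — two `κ`-normalised generators act identically on the tower points;
  `col_precomp_inv_of_pin` — ANY map pinned by the plus congruences (5) + uniqueness (6) along a datum `(g, d)` has the relational twist
  (landed `SignedColemanImage.plusCongr_precomp_inv`).
* §3 `hERL_of_unit_smul` — the value clause `∃ u ≠ 0, e (𝒸 z) = D·(Lm·u)` is invariant under `𝒸 ↦ w • 𝒸`, `w ∈ R⟦X⟧ˣ`; `lamTwo_eq_of_linearEquiv`.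
* §4 (the pins) `OnePairPins.col_precomp_inv` (the pins' own twist along ANY `κ`-generator), **`OnePairPins.exists_unit_mul_col`** (THE TORSOR: any
  onto, plus-kernel, twisted `col'` at `π.v` is `u · π.col`), `OnePairPins.exists_unit_mul_col_of_pin` (from a raw second pinned datum, with the
  H-FAM corollary), `OnePairPins.cvec'_eq_unit_smul` (`𝒸' = u • π.cvec`), `OnePairPins.lamTwo_colocdQuot_eq_of_unit` (clause (7) is torsor-invariant).

References: [Kobayashi2003] Thm. 6.2, §8 Prop. 8.18–8.19, (8.20)–(8.26) (pp. 17–21); [Kato2004Asterisque] Thm. 12.5 (1) (p. 222), §13.8 (p. 228);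
[Sprung2012] Prop. 7.3, Lemma 7.10; [Lang1990] Ch. 3 §1, Ch. 5 §1, Ch. 6 §2; [Washington1997] §13.2.
-/

set_option autoImplicit false
-- the Theorems namespace of this sub repeats the summit name by design (D-0017 nested layout)
set_option linter.dupNamespace false

noncomputable section

open Function

/-! ## §1–§3 Generic: the torsor lemma, generator-independence, the twist from a pin, and the consumers' unit-blindness -/

namespace Summit.BirchSwinnertonDyer.BirchSwinnertonDyer.Theorems.ThetaTransport.ColemanPlusTorsor

universe u

/-! ### §1 Pure algebra: pinned surjections onto `A⟦X⟧` with a common kernel and a common `(1+X)`-twist form an `A⟦X⟧ˣ`-torsor -/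

section Algebra

variable {A : Type*} [CommRing A] {M : Type*} [AddCommGroup M] [Module A M]

/-- `X`-adic separatedness of `A⟦X⟧`: an element divisible by every `X^N` is `0`. Port of k1-g23 §1. [cite: Lang1990, Ch. 5 §1 (p. 94)] -/
theorem powerSeries_eq_zero_of_forall_X_pow (v : PowerSeries A)
    (h : ∀ N : ℕ, ∃ w : PowerSeries A, v = (PowerSeries.X : PowerSeries A) ^ N • w) : v = 0 := by
  ext m
  obtain ⟨w, hw⟩ := h (m + 1)
  rw [hw, smul_eq_mul, PowerSeries.coeff_X_pow_mul', if_neg (by omega), map_zero]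

/-- **L1.** An `A`-linear self-map of `A⟦X⟧` commuting with multiplication by `X` is multiplication by its value at `1` (the landed finite-to-full
lemma `ColemanSideInjective.apply_smul_eq_smul_of_X_of_C` at `H = V = Λ_𝒪 = A⟦X⟧`, `j = id`, `S = ⊤`). Port of k1-g23 §1.
[cite: Lang1990, Ch. 6 §2 (p. 111)] -/
theorem eq_mul_map_one_of_map_X_mul (φ : PowerSeries A →ₗ[A] PowerSeries A)
    (hφ : ∀ f, φ (PowerSeries.X * f) = PowerSeries.X * φ f) (f : PowerSeries A) : φ f = f * φ 1 := by
  have h := Theorems.ColemanSideInjective.apply_smul_eq_smul_of_X_of_C (A := A) (ΛO := PowerSeries A)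
    (H := PowerSeries A) (V := PowerSeries A) powerSeries_eq_zero_of_forall_X_pow (RingHom.id (PowerSeries A))
    φ.toAddMonoidHom ⊤
    (fun x _ => by simpa only [RingHom.id_apply, LinearMap.toAddMonoidHom_coe, smul_eq_mul] using hφ x)
    (fun a x _ => by
      simp only [RingHom.id_apply, LinearMap.toAddMonoidHom_coe, smul_eq_mul, ← PowerSeries.smul_eq_C_mul, map_smul])
    f 1 trivial
  simpa only [RingHom.id_apply, LinearMap.toAddMonoidHom_coe, smul_eq_mul, mul_one] using h

/-- First isomorphism theorem, as used here: `col₂` factors `A`-linearly through the surjection `col₁` when `ker col₁ ≤ ker col₂`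
(the sketch's `descend`, kept as an existence statement so that no definition is introduced). [cite: Lang1990, Ch. 3 §1] -/
theorem exists_factor_of_ker_le (col₁ col₂ : M →ₗ[A] PowerSeries A) (hs₁ : Surjective col₁)
    (hk : LinearMap.ker col₁ ≤ LinearMap.ker col₂) :
    ∃ φ : PowerSeries A →ₗ[A] PowerSeries A, ∀ z, φ (col₁ z) = col₂ z :=
  ⟨((LinearMap.ker col₁).liftQ col₂ hk) ∘ₗ (col₁.quotKerEquivOfSurjective hs₁).symm.toLinearMap, fun z => by
    simp [LinearMap.quotKerEquivOfSurjective_symm_apply, Submodule.liftQ_apply]⟩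

/-- **L2 · THE TORSOR LEMMA.** Two surjective `A`-linear maps `M → A⟦X⟧` with the same kernel and the same twist `colᵢ (τ z) = (1 + X) · colᵢ z`
differ by a unit: `col₂ = u · col₁`, `u ∈ A⟦X⟧ˣ` (factor both ways; each factor map commutes with `X`, hence is multiplication by a constant
by L1; the two constants multiply to `1`). Port of k1-g23 §1. [cite: Kobayashi2003, Thm. 6.2, Prop. 8.18–8.19 (pp. 18–20)] [cite: Lang1990, Ch. 6 §2] -/
theorem exists_unit_mul_eq_of_twist (τ : M → M) (col₁ col₂ : M →ₗ[A] PowerSeries A)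
    (h₁ : ∀ z, col₁ (τ z) = (1 + PowerSeries.X) * col₁ z) (h₂ : ∀ z, col₂ (τ z) = (1 + PowerSeries.X) * col₂ z)
    (hs₁ : Surjective col₁) (hs₂ : Surjective col₂) (hker : ∀ z, col₁ z = 0 ↔ col₂ z = 0) :
    ∃ u : (PowerSeries A)ˣ, ∀ z, col₂ z = (u : PowerSeries A) * col₁ z := by
  have hk₁₂ : LinearMap.ker col₁ ≤ LinearMap.ker col₂ := fun z hz => by
    rw [LinearMap.mem_ker] at hz ⊢; exact (hker z).1 hz
  have hk₂₁ : LinearMap.ker col₂ ≤ LinearMap.ker col₁ := fun z hz => by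
    rw [LinearMap.mem_ker] at hz ⊢; exact (hker z).2 hz
  obtain ⟨φ, hφ⟩ := exists_factor_of_ker_le col₁ col₂ hs₁ hk₁₂
  obtain ⟨ψ, hψ⟩ := exists_factor_of_ker_le col₂ col₁ hs₂ hk₂₁
  have hφX : ∀ f, φ (PowerSeries.X * f) = PowerSeries.X * φ f := by
    intro f
    obtain ⟨z, rfl⟩ := hs₁ f
    have e1 : PowerSeries.X * col₁ z = col₁ (τ z) - col₁ z := by rw [h₁]; ring
    rw [e1, ← map_sub, hφ, map_sub, hφ, h₂]; ring
  have hψX : ∀ f, ψ (PowerSeries.X * f) = PowerSeries.X * ψ f := by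
    intro f
    obtain ⟨z, rfl⟩ := hs₂ f
    have e1 : PowerSeries.X * col₂ z = col₂ (τ z) - col₂ z := by rw [h₂]; ring
    rw [e1, ← map_sub, hψ, map_sub, hψ, h₁]; ring
  have hφ1 := eq_mul_map_one_of_map_X_mul φ hφX
  have hψ1 := eq_mul_map_one_of_map_X_mul ψ hψX
  obtain ⟨z₁, hz₁⟩ := hs₁ 1
  have hmul : φ 1 * ψ 1 = 1 := by
    have h : ψ (φ 1) = 1 := by rw [← hz₁, hφ, hψ]
    rwa [hψ1] at h
  refine ⟨Units.mkOfMulEqOne _ _ hmul, fun z => ?_⟩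
  rw [Units.val_mkOfMulEqOne, ← hφ, hφ1, mul_comm]

end Algebra

/-! ### §2 Tower points: generator-independence, and the relational twist from a pin -/

section Tower

open Literature.NumberTheory.EllipticCurves Literature.NumberTheory.GaloisRepresentations
  Literature.NumberTheory.EllipticCurves.Sprung2012 Literature.NumberTheory.EllipticCurves.Kobayashi2003

variable {K : Type u} [Field K] {p : ℕ} [Fact p.Prime] (κ : ZpExtension K p)
  {E : Type u} [Field E] [Algebra K E] (ι : AlgebraicClosure K →ₐ[K] AlgebraicClosure E) (W : WeierstrassCurve K)

/-- **L0.** Two `κ`-normalised topological generators act identically on the tower points `E(K_∞·E)` (their quotient lies in `ker κ`, which fixes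
`localTowerPointsOfEmb`). Port of k1-g23 §2. [cite: Washington1997, §13.2] [cite: Sprung2012, Lemma 7.10 (p. 1503)] -/
theorem smul_eq_of_isTopGenerator {g g' : Field.absoluteGaloisGroup E}
    (hg : κ.IsTopGenerator (resGalOfEmb ι g)) (hg' : κ.IsTopGenerator (resGalOfEmb ι g'))
    {P : localPoints W E} (hP : P ∈ localTowerPointsOfEmb κ ι W) : g' • P = g • P := by
  have hmem : g⁻¹ * g' ∈ localSubgroupOfEmb κ.kerSubgroup ι := by
    rw [ZpExtension.IsTopGenerator] at hg hg'
    rw [mem_localSubgroupOfEmb_iff, ZpExtension.mem_kerSubgroup, map_mul, map_inv, map_mul, map_inv, hg, hg',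
      inv_mul_cancel]
  have h := (mem_localTowerPointsOfEmb_iff κ ι W P).1 hP _ hmem
  calc g' • P = (g * (g⁻¹ * g')) • P := by rw [mul_inv_cancel_left]
    _ = g • P := by rw [mul_smul, h]

/-- **L0⁻¹.** Same for the inverses: `g'⁻¹ • P = g⁻¹ • P` on the tower points. Port of k1-g23 §2. [cite: Washington1997, §13.2] -/
theorem inv_smul_eq_of_isTopGenerator {g g' : Field.absoluteGaloisGroup E}
    (hg : κ.IsTopGenerator (resGalOfEmb ι g)) (hg' : κ.IsTopGenerator (resGalOfEmb ι g'))
    {P : localPoints W E} (hP : P ∈ localTowerPointsOfEmb κ ι W) : g'⁻¹ • P = g⁻¹ • P := by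
  have h := smul_eq_of_isTopGenerator κ ι W hg hg' (smul_mem_localTowerPointsOfEmb κ ι W g⁻¹ hP)
  rw [smul_inv_smul] at h
  calc g'⁻¹ • P = g'⁻¹ • (g' • g⁻¹ • P) := by rw [h]
    _ = g⁻¹ • P := inv_smul_smul g' _

end Tower

section Twist

open scoped Classical
open Polynomial Finset
open Literature.NumberTheory.EllipticCurves Literature.NumberTheory.GaloisRepresentations NumberField IsDedekindDomain Field
  Literature.NumberTheory.EllipticCurves.Sprung2012 Literature.NumberTheory.EllipticCurves.Kobayashi2003
  Summit.BirchSwinnertonDyer.BirchSwinnertonDyer.Theorems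

variable (W : WeierstrassCurve ℚ) (κ : ZpExtension ℚ 2) (v : HeightOneSpectrum (𝓞 ℚ))
  {O : Type*} [CommRing O]

/-- **THE TWIST FROM A PIN, relational currency.** Any `O`-valued map `col` pinned by the plus congruences (5) and uniqueness (6) along a datum
`(g, d)` with `g` a `κ`-generator and `d m ∈ E(ℚ_{m,v})` satisfies `col z' = (1 + X) · col z` whenever `z' a = z (g⁻¹ • a)` on the tower points
(landed `SignedColemanImage.plusCongr_precomp_inv` on the orbit of `d (2m)`, `g^{4^m} d(2m) = d(2m)`; uniqueness pins it — the argument of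
`SignedColemanImage.exists_colemanPlusHom_coeff_two_twist`, for an ABSTRACT pinned map). Port of k1-g23 §2b (there through a precomposition map;
here in the tree's relational form). [cite: Kobayashi2003, Thm. 6.2 (6.13), §8 (8.20)–(8.23)] [cite: Sprung2012, Prop. 7.3] -/
theorem col_precomp_inv_of_pin
    (col : (↥(localTowerPointsOfEmb κ (closureEmb (K := ℚ) (v.adicCompletion ℚ)) W) →+ O) → PowerSeries O)
    (g : absoluteGaloisGroup (v.adicCompletion ℚ)) (d : ℕ → localPoints W (v.adicCompletion ℚ))
    (hdA : ∀ m j, g ^ j • d m ∈ localTowerPointsOfEmb κ (closureEmb (K := ℚ) (v.adicCompletion ℚ)) W)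
    (hg : κ.IsTopGenerator (resGalOfEmb (closureEmb (K := ℚ) (v.adicCompletion ℚ)) g))
    (hd : ∀ m, d m ∈ localLayerPointsOfEmb κ (closureEmb (K := ℚ) (v.adicCompletion ℚ)) W m)
    (hcong : ∀ (z : ↥(localTowerPointsOfEmb κ (closureEmb (K := ℚ) (v.adicCompletion ℚ)) W) →+ O) (m : ℕ),
      (((cyclotomicOmega 2 (2 * m)).map (Int.castRingHom O) : O[X]) : PowerSeries O) ∣
        ((∑ j ∈ range (2 ^ (2 * m)), C (z ⟨g ^ j • d (2 * m), hdA (2 * m) j⟩) * (X + 1) ^ j : O[X]) : PowerSeries O) +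
          (-1 : PowerSeries O) ^ m * (((cyclotomicOmegaMinus 2 (2 * m)).map (Int.castRingHom O) : O[X]) : PowerSeries O) * col z)
    (hpin : ∀ (z : ↥(localTowerPointsOfEmb κ (closureEmb (K := ℚ) (v.adicCompletion ℚ)) W) →+ O) (L : PowerSeries O),
      (∀ m : ℕ, (((cyclotomicOmega 2 (2 * m)).map (Int.castRingHom O) : O[X]) : PowerSeries O) ∣
        ((∑ j ∈ range (2 ^ (2 * m)), C (z ⟨g ^ j • d (2 * m), hdA (2 * m) j⟩) * (X + 1) ^ j : O[X]) : PowerSeries O) +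
          (-1 : PowerSeries O) ^ m * (((cyclotomicOmegaMinus 2 (2 * m)).map (Int.castRingHom O) : O[X]) : PowerSeries O) * L) →
      L = col z)
    (z z' : ↥(localTowerPointsOfEmb κ (closureEmb (K := ℚ) (v.adicCompletion ℚ)) W) →+ O)
    (hz' : ∀ a : ↥(localTowerPointsOfEmb κ (closureEmb (K := ℚ) (v.adicCompletion ℚ)) W),
      z' a = z ⟨g⁻¹ • (a : localPoints W (v.adicCompletion ℚ)), smul_mem_localTowerPointsOfEmb κ _ W g⁻¹ a.2⟩) :
    col z' = (1 + PowerSeries.X) * col z := by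
  refine (hpin _ _ fun m => ?_).symm
  have hfix : g ^ 2 ^ (2 * m) • d (2 * m) = d (2 * m) := by
    simpa using pow_mul_smul_of_mem_localLayerPointsOfEmb κ (closureEmb (K := ℚ) (v.adicCompletion ℚ)) W hg (hd (2 * m)) 1
  have hω : (((cyclotomicOmega 2 (2 * m)).map (Int.castRingHom O) : O[X]) : PowerSeries O) =
      (((X + 1) ^ 2 ^ (2 * m) - 1 : O[X]) : PowerSeries O) := by
    rw [SignedColemanImage.map_cyclotomicOmega]
  rw [hω]
  exact SignedColemanImage.plusCongr_precomp_inv (localTowerPointsOfEmb κ (closureEmb (K := ℚ) (v.adicCompletion ℚ)) W)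
    (fun σ a ha ↦ smul_mem_localTowerPointsOfEmb κ _ W σ ha) g (pow_pos two_pos _) (d (2 * m)) hfix (hdA (2 * m))
    z z' hz' _ (col z) (by have := hcong z m; rwa [hω] at this)

end Twist

/-! ### §3 Consumer side: a `Λ`-unit is invisible to `hERL` and to the `λ_{ℤ_p}` currency -/

section Consumer

/-- **`hERL` absorbs a `Λ`-unit.** In the binder shape of the `(i)`-half price node (`price_of_parts`): if `e` is `Λ`-semilinear
(`e (r • t) = map ι r · e t`) and the value identity `e (w • c) = D·(Lm·u)`, `u ≠ 0`, holds for `w • c` with `w ∈ R⟦X⟧ˣ`, then it holds for `c`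
(with `u · (map ι w)⁻¹`). Port of k1-g23 §4. [cite: Kato2004Asterisque, Thm. 12.5 (1) (p. 222)] [cite: Kobayashi2003, Thm. 1.3 (ii)] -/
theorem hERL_of_unit_smul {R 𝒪 : Type*} [CommRing R] [CommRing 𝒪] {n : ℕ} (ι : R →+* 𝒪)
    (e : (Fin n → PowerSeries R) ≃+ PowerSeries 𝒪)
    (he : ∀ (r : PowerSeries R) (t : Fin n → PowerSeries R), e (r • t) = PowerSeries.map ι r * e t)
    (w : (PowerSeries R)ˣ) (c : Fin n → PowerSeries R) (D Lm : PowerSeries 𝒪)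
    (h : ∃ u : PowerSeries 𝒪, u ≠ 0 ∧ e ((w : PowerSeries R) • c) = D * (Lm * u)) :
    ∃ u : PowerSeries 𝒪, u ≠ 0 ∧ e c = D * (Lm * u) := by
  obtain ⟨u, hu, hval⟩ := h
  obtain ⟨v, hv⟩ := (w.isUnit).map (PowerSeries.map ι)
  refine ⟨u * ↑v⁻¹, fun h0 => hu ?_, ?_⟩
  · have h1 := congrArg (· * (v : PowerSeries 𝒪)) h0
    simpa only [mul_assoc, Units.inv_mul, mul_one, zero_mul] using h1
  · have h2 : (v : PowerSeries 𝒪) * e c = D * (Lm * u) := by rw [hv, ← he, hval]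
    calc e c = ↑v⁻¹ * ((v : PowerSeries 𝒪) * e c) := by rw [← mul_assoc, Units.inv_mul, one_mul]
      _ = D * (Lm * (u * ↑v⁻¹)) := by rw [h2]; ring

/-- Transport of `lamTwo` and of the finiteness clause along a `ℤ_p`-linear equivalence (base change to `ℚ_p`). Port of k1-g23 §4.
[cite: Kato2004Asterisque, §13.8 (p. 228)] -/
theorem lamTwo_eq_of_linearEquiv {p : ℕ} [Fact p.Prime] {X Y : Type*} [AddCommGroup X] [Module ℤ_[p] X]
    [AddCommGroup Y] [Module ℤ_[p] Y] (e : X ≃ₗ[ℤ_[p]] Y) :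
    Theorems.OnePair.lamTwo p X = Theorems.OnePair.lamTwo p Y ∧
      (Module.Finite ℚ_[p] (TensorProduct ℤ_[p] ℚ_[p] X) → Module.Finite ℚ_[p] (TensorProduct ℤ_[p] ℚ_[p] Y)) := by
  rw [Theorems.OnePair.lamTwo_eq, Theorems.OnePair.lamTwo_eq]
  exact ⟨(e.baseChange ℤ_[p] ℚ_[p] X Y).finrank_eq, fun _ => Module.Finite.equiv (e.baseChange ℤ_[p] ℚ_[p] X Y)⟩

/-- `M ⧸ span c(T) ≃ₗ[Λ] M ⧸ span (u • c)(T)` for `u ∈ Λˣ` (multiplication by `u`; the sketch's `quotSpanImageSmulEquiv`, kept as an existence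
statement so that no definition is introduced). [cite: Lang1990, Ch. 3 §1] -/
theorem nonempty_quotSpanImage_equiv_smul {Λ : Type*} [CommRing Λ] {M X : Type*} [AddCommGroup M] [Module Λ M]
    (u : Λˣ) (c : X → M) (T : Set X) :
    Nonempty ((M ⧸ Submodule.span Λ (c '' T)) ≃ₗ[Λ] (M ⧸ Submodule.span Λ ((fun x => (u : Λ) • c x) '' T))) :=
  ⟨Submodule.Quotient.equiv _ _ (LinearEquiv.smulOfUnit u) (by
    rw [Submodule.map_span, Set.image_image]
    rfl)⟩

end Consumer

end Summit.BirchSwinnertonDyer.BirchSwinnertonDyer.Theorems.ThetaTransport.ColemanPlusTorsor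

/-! ## §4 The pins: every other pinned plus Coleman map at `π.v` is `u · π.col`, `u ∈ ℤ₂⟦X⟧ˣ` -/

namespace Summit.BirchSwinnertonDyer.BirchSwinnertonDyer.Theorems.OnePair

open scoped Classical
open Polynomial Finset
open Literature.NumberTheory.EllipticCurves Literature.NumberTheory.EllipticCurves.GreenbergSelmer
  Literature.NumberTheory.GaloisRepresentations NumberField IsDedekindDomain Field WeierstrassCurve
  Literature.NumberTheory.EllipticCurves.Kobayashi2003 Literature.NumberTheory.EllipticCurves.Sprung2012
  Literature.NumberTheory.EllipticCurves.CyclotomicLayer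
  Summit.BirchSwinnertonDyer.BirchSwinnertonDyer.Theorems
  Summit.BirchSwinnertonDyer.BirchSwinnertonDyer.Theorems.ThetaTransport.ColemanPlusTorsor

namespace OnePairPins

variable {S : Set (PadicAlgCl 2)} {W : WeierstrassCurve ℚ} [W.IsElliptic] {κ : ZpExtension ℚ 2} {γ : absoluteGaloisGroup ℚ}
  {S₀ : Finset (HeightOneSpectrum (𝓞 ℚ))} {n : ℕ} {ρ : FramedGaloisRep ℚ ↥(padicCoeffIntegers S) 2}
  {Θ : ∀ v : HeightOneSpectrum (𝓞 ℚ), ((2 : ℕ) : 𝓞 ℚ) ∈ v.asIdeal → (Cofree ρ ↥(padicCoeffField S) ≃+ (Fin n → ↥(W.geomPrimaryTorsion 2)))}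
  {hΘ : ∀ v hv (δ : absoluteGaloisGroup (v.adicCompletion ℚ)) m i,
    Θ v hv (resGalOfEmb (closureEmb (K := ℚ) (v.adicCompletion ℚ)) δ • m) i = resGalOfEmb (closureEmb (K := ℚ) (v.adicCompletion ℚ)) δ • Θ v hv m i}
  {I : Kato2004.IwasawaH1DataCoeff (FramedGaloisRep.toGaloisRep ρ) 2 κ γ}
  {Sg : AddSubgroup (subgroupH1 κ.kerSubgroup (Cofree ρ ↥(padicCoeffField S)))} [Module ↥(padicCoeffIntegers S) ↥Sg]
  (π : OnePairPins S W κ γ S₀ n ρ Θ hΘ I Sg)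

/-- **The pins' own twist along ANY `κ`-generator `g'`**, relational currency: `π.col z' = (1 + X) · π.col z` whenever `z' a = z (g'⁻¹ • a)` on the
tower points (`π.hcol`'s own generator `gH` and `g'` act identically there, L0⁻¹; then `col_precomp_inv_of_pin` on `π.hcol`'s datum). Port of k1-g23 §3;
cf. k4 g20 `exists_col_twist`. [cite: Kobayashi2003, Thm. 6.2 (6.13)] [cite: Washington1997, §13.2] -/
theorem col_precomp_inv (g' : absoluteGaloisGroup (π.v.adicCompletion ℚ))
    (hg' : κ.IsTopGenerator (resGalOfEmb (closureEmb (K := ℚ) (π.v.adicCompletion ℚ)) g'))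
    (z z' : ↥(localTowerPointsOfEmb κ (closureEmb (K := ℚ) (π.v.adicCompletion ℚ)) W) →+ ℤ_[2])
    (hz' : ∀ a : ↥(localTowerPointsOfEmb κ (closureEmb (K := ℚ) (π.v.adicCompletion ℚ)) W),
      z' a = z ⟨g'⁻¹ • (a : localPoints W (π.v.adicCompletion ℚ)), smul_mem_localTowerPointsOfEmb κ _ W g'⁻¹ a.2⟩) :
    π.col z' = (1 + PowerSeries.X) * π.col z := by
  obtain ⟨gH, dH, hdA, hg, hd, -, -, hcong, hpin⟩ := π.hcol
  refine col_precomp_inv_of_pin W κ π.v π.col gH dH hdA hg hd hcong hpin z z' fun a ↦ ?_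
  rw [hz' a]
  exact congrArg z (Subtype.ext (inv_smul_eq_of_isTopGenerator κ (closureEmb (K := ℚ) (π.v.adicCompletion ℚ)) W hg hg' a.2))

/-- **L3 · THE PINNED PLUS COLEMAN MAPS AT `v` ARE A `ℤ₂⟦X⟧ˣ`-TORSOR.** For the pins `π` and ANY second `ℤ₂`-linear map `col'` on the functionals of the
tower points at `π.v` that is onto, has the datum-free kernel «`z` kills every plus layer», and has the relational `(1+X)`-twist along some `κ`-generator
`g'` (e.g. the output of `SignedColemanImage.exists_colemanPlusHom_coeff_two_twist` at `O := ℤ₂`, or the explicit TP2 family's map):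
`col' = u · π.col` with `u ∈ ℤ₂⟦X⟧ˣ`. Port of k1-g23 §3 (S129); cf. k2 g22 `col_eq_unit_mul_of_datum`.
[cite: Kobayashi2003, Thm. 6.2, §8 Prop. 8.18–8.19, (8.23)] [cite: Kato2004Asterisque, §13.8] -/
theorem exists_unit_mul_col
    (col' : (↥(localTowerPointsOfEmb κ (closureEmb (K := ℚ) (π.v.adicCompletion ℚ)) W) →+ ℤ_[2]) →ₗ[ℤ_[2]] PowerSeries ℤ_[2])
    (g' : absoluteGaloisGroup (π.v.adicCompletion ℚ))
    (hg' : κ.IsTopGenerator (resGalOfEmb (closureEmb (K := ℚ) (π.v.adicCompletion ℚ)) g'))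
    (htw' : ∀ (z z' : ↥(localTowerPointsOfEmb κ (closureEmb (K := ℚ) (π.v.adicCompletion ℚ)) W) →+ ℤ_[2]),
      (∀ a : ↥(localTowerPointsOfEmb κ (closureEmb (K := ℚ) (π.v.adicCompletion ℚ)) W),
        z' a = z ⟨g'⁻¹ • (a : localPoints W (π.v.adicCompletion ℚ)), smul_mem_localTowerPointsOfEmb κ _ W g'⁻¹ a.2⟩) →
      col' z' = (1 + PowerSeries.X) * col' z)
    (hsurj' : Surjective col')
    (hker' : ∀ z : ↥(localTowerPointsOfEmb κ (closureEmb (K := ℚ) (π.v.adicCompletion ℚ)) W) →+ ℤ_[2],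
      col' z = 0 ↔ ∀ (m : ℕ) (x : localPoints W (π.v.adicCompletion ℚ)) (hx : x ∈ signedLocalPoints κ (π.v.adicCompletion ℚ) W 1 m),
        z ⟨x, localLayerPointsOfEmb_le_localTowerPointsOfEmb κ (closureEmb (K := ℚ) (π.v.adicCompletion ℚ)) W m
          (signedLocalPointsOfEmb_le κ (closureEmb (K := ℚ) (π.v.adicCompletion ℚ)) W 1 m hx)⟩ = 0) :
    ∃ u : (PowerSeries ℤ_[2])ˣ, ∀ z, col' z = (u : PowerSeries ℤ_[2]) * π.col z := by
  -- precomposition with `g'⁻¹` on the tower points (the sketch's `towerPrecomp`, built locally)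
  let φ : ↥(localTowerPointsOfEmb κ (closureEmb (K := ℚ) (π.v.adicCompletion ℚ)) W) →+
      ↥(localTowerPointsOfEmb κ (closureEmb (K := ℚ) (π.v.adicCompletion ℚ)) W) :=
    { toFun := fun a => ⟨g'⁻¹ • (a : localPoints W (π.v.adicCompletion ℚ)), smul_mem_localTowerPointsOfEmb κ _ W g'⁻¹ a.2⟩
      map_zero' := by ext; simp
      map_add' := fun a b => by ext; simp [smul_add] }
  exact exists_unit_mul_eq_of_twist (fun z => z.comp φ) π.col col'
    (fun z => π.col_precomp_inv g' hg' z (z.comp φ) fun _ => rfl) (fun z => htw' z (z.comp φ) fun _ => rfl)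
    π.hcol_surj hsurj' (fun z => (π.hcol_ker z).trans (hker' z).symm)

/-- **L3 from a raw pinned datum, with the H-FAM corollary.** If `col'` is pinned by (5)+(6) along a second datum `(g', d')` at `π.v` (GEN, L) and is
onto with the datum-free kernel, then `col' = u · π.col` with `u ∈ Λˣ`, AND the second datum's congruence (5) holds for `u · π.col` — the H-FAM clause
with the slack identified as ONE `Λ`-unit (the literal «(5) along `(g', d')` for `π.col` itself» would force `u = 1` and is not asserted). Port of
k1-g23 §3. [cite: Kobayashi2003, §8 (8.20)–(8.26)] [cite: Kato2004Asterisque, Thm. 12.5 (1)] -/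
theorem exists_unit_mul_col_of_pin
    (col' : (↥(localTowerPointsOfEmb κ (closureEmb (K := ℚ) (π.v.adicCompletion ℚ)) W) →+ ℤ_[2]) →ₗ[ℤ_[2]] PowerSeries ℤ_[2])
    (g' : absoluteGaloisGroup (π.v.adicCompletion ℚ)) (d' : ℕ → localPoints W (π.v.adicCompletion ℚ))
    (hdA' : ∀ m j, g' ^ j • d' m ∈ localTowerPointsOfEmb κ (closureEmb (K := ℚ) (π.v.adicCompletion ℚ)) W)
    (hg' : κ.IsTopGenerator (resGalOfEmb (closureEmb (K := ℚ) (π.v.adicCompletion ℚ)) g'))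
    (hd' : ∀ m, d' m ∈ localLayerPointsOfEmb κ (closureEmb (K := ℚ) (π.v.adicCompletion ℚ)) W m)
    (hcong' : ∀ (z : ↥(localTowerPointsOfEmb κ (closureEmb (K := ℚ) (π.v.adicCompletion ℚ)) W) →+ ℤ_[2]) (m : ℕ),
      (((cyclotomicOmega 2 (2 * m)).map (Int.castRingHom ℤ_[2]) : ℤ_[2][X]) : PowerSeries ℤ_[2]) ∣
        ((∑ j ∈ range (2 ^ (2 * m)), C (z ⟨g' ^ j • d' (2 * m), hdA' (2 * m) j⟩) * (X + 1) ^ j : ℤ_[2][X]) : PowerSeries ℤ_[2]) +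
          (-1 : PowerSeries ℤ_[2]) ^ m * (((cyclotomicOmegaMinus 2 (2 * m)).map (Int.castRingHom ℤ_[2]) : ℤ_[2][X]) : PowerSeries ℤ_[2]) *
            col' z)
    (hpin' : ∀ (z : ↥(localTowerPointsOfEmb κ (closureEmb (K := ℚ) (π.v.adicCompletion ℚ)) W) →+ ℤ_[2]) (L : PowerSeries ℤ_[2]),
      (∀ m : ℕ, (((cyclotomicOmega 2 (2 * m)).map (Int.castRingHom ℤ_[2]) : ℤ_[2][X]) : PowerSeries ℤ_[2]) ∣
        ((∑ j ∈ range (2 ^ (2 * m)), C (z ⟨g' ^ j • d' (2 * m), hdA' (2 * m) j⟩) * (X + 1) ^ j : ℤ_[2][X]) : PowerSeries ℤ_[2]) +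
          (-1 : PowerSeries ℤ_[2]) ^ m * (((cyclotomicOmegaMinus 2 (2 * m)).map (Int.castRingHom ℤ_[2]) : ℤ_[2][X]) : PowerSeries ℤ_[2]) *
            L) → L = col' z)
    (hsurj' : Surjective col')
    (hker' : ∀ z : ↥(localTowerPointsOfEmb κ (closureEmb (K := ℚ) (π.v.adicCompletion ℚ)) W) →+ ℤ_[2],
      col' z = 0 ↔ ∀ (m : ℕ) (x : localPoints W (π.v.adicCompletion ℚ)) (hx : x ∈ signedLocalPoints κ (π.v.adicCompletion ℚ) W 1 m),
        z ⟨x, localLayerPointsOfEmb_le_localTowerPointsOfEmb κ (closureEmb (K := ℚ) (π.v.adicCompletion ℚ)) W m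
          (signedLocalPointsOfEmb_le κ (closureEmb (K := ℚ) (π.v.adicCompletion ℚ)) W 1 m hx)⟩ = 0) :
    ∃ u : (PowerSeries ℤ_[2])ˣ, (∀ z, col' z = (u : PowerSeries ℤ_[2]) * π.col z) ∧
      ∀ (z : ↥(localTowerPointsOfEmb κ (closureEmb (K := ℚ) (π.v.adicCompletion ℚ)) W) →+ ℤ_[2]) (m : ℕ),
        (((cyclotomicOmega 2 (2 * m)).map (Int.castRingHom ℤ_[2]) : ℤ_[2][X]) : PowerSeries ℤ_[2]) ∣
          ((∑ j ∈ range (2 ^ (2 * m)), C (z ⟨g' ^ j • d' (2 * m), hdA' (2 * m) j⟩) * (X + 1) ^ j : ℤ_[2][X]) : PowerSeries ℤ_[2]) +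
            (-1 : PowerSeries ℤ_[2]) ^ m * (((cyclotomicOmegaMinus 2 (2 * m)).map (Int.castRingHom ℤ_[2]) : ℤ_[2][X]) : PowerSeries ℤ_[2]) *
              ((u : PowerSeries ℤ_[2]) * π.col z) := by
  obtain ⟨u, hu⟩ := π.exists_unit_mul_col col' g' hg'
    (col_precomp_inv_of_pin W κ π.v col' g' d' hdA' hg' hd' hcong' hpin') hsurj' hker'
  exact ⟨u, hu, fun z m => by rw [← hu]; exact hcong' z m⟩

/-- **`𝒸' = u • 𝒸`.** The coordinate vector built from `col'` through the SAME glue `π.locd₂` is `u •` the pins' `π.cvec` (T78: same glue). Port of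
k1-g23 §3. [cite: Kobayashi2003, Thm. 6.2 (p. 18)] -/
theorem cvec'_eq_unit_smul
    (col' : (↥(localTowerPointsOfEmb κ (closureEmb (K := ℚ) (π.v.adicCompletion ℚ)) W) →+ ℤ_[2]) →ₗ[ℤ_[2]] PowerSeries ℤ_[2])
    (u : (PowerSeries ℤ_[2])ˣ) (hu : ∀ z, col' z = (u : PowerSeries ℤ_[2]) * π.col z) (x : I.H) :
    (fun i => col' ((π.locd₂ x).comp (AddMonoidHom.single
      (fun _ : Fin n => ↥(localTowerPointsOfEmb κ (closureEmb (K := ℚ) (π.v.adicCompletion ℚ)) W)) i))) =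
      (u : PowerSeries ℤ_[2]) • π.cvec x := by
  funext i
  rw [Pi.smul_apply, smul_eq_mul, cvec_apply, hu]

/-- **Clause (7) is torsor-invariant.** The `λ_{ℤ₂}` count and the finiteness clause of `stub_katoZetaCMAtTwo` (S3″) computed with the coordinate
vector `u • π.cvec` of ANY other pinned plus Coleman map `col' = u · π.col` equal those of `π.colocdQuot z`. Port of k1-g23 §3.
[cite: Kato2004Asterisque, Thm. 12.5 (1) (p. 222), §13.8 (p. 228)] -/
theorem lamTwo_colocdQuot_eq_of_unit (u : (PowerSeries ℤ_[2])ˣ) (z : I.H) :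
    lamTwo 2 ((Fin n → PowerSeries ℤ_[2]) ⧸ Submodule.span (PowerSeries ℤ_[2])
        ((fun x => (u : PowerSeries ℤ_[2]) • π.cvec x) '' (↑(Submodule.span (IwasawaAlgebraO S) ({z} : Set I.H)) : Set I.H))) =
      lamTwo 2 (π.colocdQuot z) ∧
    (Module.Finite ℚ_[2] (TensorProduct ℤ_[2] ℚ_[2] ((Fin n → PowerSeries ℤ_[2]) ⧸ Submodule.span (PowerSeries ℤ_[2])
        ((fun x => (u : PowerSeries ℤ_[2]) • π.cvec x) '' (↑(Submodule.span (IwasawaAlgebraO S) ({z} : Set I.H)) : Set I.H)))) →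
      Module.Finite ℚ_[2] (TensorProduct ℤ_[2] ℚ_[2] (π.colocdQuot z))) := by
  obtain ⟨e⟩ := nonempty_quotSpanImage_equiv_smul u π.cvec (↑(Submodule.span (IwasawaAlgebraO S) ({z} : Set I.H)) : Set I.H)
  exact lamTwo_eq_of_linearEquiv (e.symm.restrictScalars ℤ_[2])

end OnePairPins

end Summit.BirchSwinnertonDyer.BirchSwinnertonDyer.Theorems.OnePair

end
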